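import Summits.BirchSwinnertonDyer.BirchSwinnertonDyer.Theorems.KatoDescentPotSupersingularKatoSelmerPTOrthogonal
import HarnessLib

/-!
# The Poitou–Tate COKERNEL bound for Kato's `S(E[p^∞])`, II: the count
# `#Sel_{p^∞}(E/ℚ) · ∏_{ℓ ∈ T∖{p}} #H¹_ur(ℚ_ℓ, E[p^∞]) ≤ #S · [E(ℚ) : p^K E(ℚ)]` (companion (ii) of brick (a) of crux M's level-0 ledger)
# (route `KatoDescentPotSupersingular` / `…Tame…`, crux M = stmt-BirchSwinnertonDyer-19196; route-free helper)

Seat `bsd-potss-rkm` g19 (prover; cell `bsd-potss`), item stmt-BirchSwinnertonDyer-19196 (`--supports … --as helper`; closes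
nothing).  HONEST FRAMING: BSD is not proved by any of this; nothing is booked; theorems only (no definition, no named fact).  The
Poitou–Tate input is the FINITE-LEVEL `SelmerComplement` property of a family of local invariant maps (Milne I 4.10 (b), the tree's
predicate), carried as a hypothesis exactly as in the cell's other PT counts.

## What (memo `HOME/rkm/FINDING-19196-rkm-g19.md` §"What remains", steps P1–P4 assembled; Kato, Astérisque 295, §14.8 and proof of Prop. 14.16)

`S = H¹_{𝓤∞}(ℚ,E[p^∞]) ⊓ selmerLocalKerPrimary W ℚ_p p` (Kummer at `p`, unramified at `ℓ ≠ p`).  The map `Λ : S → ∏_{ℓ∈T∖p} H¹_ur(ℚ_ℓ,E[p^∞])` has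
kernel `⊇ Sel_{p^∞}(E/ℚ)` (part 43) and its COKERNEL is bounded by `[E(ℚ) : p^K E(ℚ)]` (`= #E(ℚ)[p^∞]` in rank `0`), whence the displayed
inequality — the direction crux M consumes (`#Ш[p^∞]·∏ c_ℓ^{(p)} ≤ #S·p^{t₀}` with g18's Néron reading `#H¹_ur = p^{v_p(c_ℓ)}`).
Proof at two finite levels `d = p^K` and `kd = p^s·p^K` (`i = inclKD`, `[p^s] = mulK`, `ι′ : E[p^s p^K] → E[p^∞]` of part 42, a level-`p^s p^K`
Weil datum with transport `w′` and descended pairing `desc`, a family `inv` at level `N = p^s p^K` with `IsPerfect` and `SelmerComplement`):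

* §0 `natCard_le_natCard_map_mul_index`, `index_ker_le_natCard` — the two counting lemmas.
* §1 (part 44a `…KatoSelmerPTOrthogonal.exists_mem_kato_of_sum_eq_zero` supplies (★): tuples `g = (g_ℓ)` killed by the functionals
  `x ↦ Σ_ℓ ⟨g_ℓ, (desc^♭)_* loc_ℓ x⟩_ℓ`, `x ∈ G₀ = Sel^{(p^K)} ⊓ ker(E[p^K] ↪ E)_*`, lift to `S`)
  **`natCard_selmerGroupPInfty_mul_prod_unramified_le`** — the count `∏#H¹_ur = #Θ(G) ≤ #Θ(ker ev)·[G : ker ev] ≤ #im Λ · #Hom(G₀, ℤ/p^s p^K) = #im Λ·#G₀`,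
  `#S = #ker Λ·#im Λ`, `#Sel_{p^∞} ≤ #ker Λ`; and `…_index` — the same with `#G₀ = [E(ℚ) : p^K E(ℚ)]` (part 41).

References: K. Kato, Astérisque 295 (2004), §14.8 (p. 238), proof of Prop. 14.16 (pp. 244–245) [Kato2004Asterisque]; J. S. Milne, *ADT* I Thm. 4.10 (b),
Cor. 2.3, Lemma 3.3, §6 [MilneADT2006]; B. Howard, Compos. Math. 140 (2004) Thm. 2.1.11 [Howard2004HeegnerKolyvagin]; R. Sakamoto, JTNB 36 (2024) §3
[Sakamoto2024].
-/

-- the summit and its single problem are both named `BirchSwinnertonDyer` (registry layout D-0017)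
set_option linter.dupNamespace false
set_option autoImplicit false

noncomputable section

open scoped Classical ContRepresentation NumberField
open CategoryTheory Function Field NumberField IsDedekindDomain WeierstrassCurve
open Literature.NumberTheory.EllipticCurves Literature.NumberTheory.GaloisRepresentations
  Literature.NumberTheory.GaloisRepresentations.DiscreteGaloisModule Literature.NumberTheory.GaloisCohomology
open Literature.NumberTheory.EllipticCurves.Kato2004
open Summit.BirchSwinnertonDyer.Rank1Residual.X11b.Levels Summit.BirchSwinnertonDyer.Rank1Residual.X11b.LocBridge
  Summit.BirchSwinnertonDyer.Rank1Residual.X11b.LevelKummer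
open Summit.BirchSwinnertonDyer.Rank1Residual.GaloisImage
open Summit.BirchSwinnertonDyer.BirchSwinnertonDyer.Theorems.KummerTowerOrthogonal

universe u

namespace Summit.BirchSwinnertonDyer.BirchSwinnertonDyer.Theorems.KatoFiniteLevelCount

/-! ## §0 Two counting lemmas -/

section Counting

/-- `#X ≤ #f(A) · [G : A]` for a surjective `f : G → X` out of a finite group and any `A ≤ G` (`[f(G) : f(A)] ∣ [G : A]`). [folklore] -/
theorem natCard_le_natCard_map_mul_index {G X : Type*} [AddCommGroup G] [AddCommGroup X] [Finite G] (f : G →+ X)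
    (hf : Surjective f) (A : AddSubgroup G) : Nat.card X ≤ Nat.card (A.map f) * A.index := by
  have h1 : Nat.card (A.map f) * (A.map f).index = Nat.card X := AddSubgroup.card_mul_index _
  have h2 : (A.map f).index ∣ A.index := AddSubgroup.index_map_dvd A hf
  have hA : A.index ≠ 0 := fun h => by
    have h' := A.card_mul_index
    rw [h, mul_zero] at h'
    exact Nat.card_pos.ne' h'.symm
  rw [← h1]
  exact Nat.mul_le_mul_left _ (Nat.le_of_dvd (Nat.pos_of_ne_zero hA) h2)

/-- `[G : ker e] ≤ #Hom(G₀, ℤ/N) = #G₀` for any `e : G → Hom(G₀, ℤ/N)` with `G₀` finite killed by `N`. [folklore] -/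
theorem index_ker_le_natCard {G G₀ : Type*} [AddCommGroup G] [AddCommGroup G₀] [Finite G₀] {N : ℕ} [NeZero N]
    (hG₀ : ∀ x : G₀, N • x = 0) (e : G →+ (G₀ →+ ZMod N)) : e.ker.index ≤ Nat.card G₀ := by
  haveI : Finite (G₀ →+ ZMod N) := Finite.of_injective (fun f : G₀ →+ ZMod N => (f : G₀ → ZMod N)) DFunLike.coe_injective
  rw [AddSubgroup.index_ker, ← Nat.card_addMonoidHom_zmod hG₀]
  exact Nat.card_le_card_of_injective _ e.range.subtype_injective

end Counting

/-! ## §1 The count -/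

section PT

variable (W : WeierstrassCurve ℚ) [W.IsElliptic] (p s k : ℕ) [Fact p.Prime]
  (T : Finset (HeightOneSpectrum (𝓞 ℚ)))
  (e : geomTorsion W ((p ^ s * p ^ k : ℕ) : ℤ) → geomTorsion W ((p ^ s * p ^ k : ℕ) : ℤ) → AlgebraicClosure ℚ)
  (hμ : ∀ S T, e S T ^ (p ^ s * p ^ k) = 1)
  (hadd₁ : ∀ S₁ S₂ T, e (S₁ + S₂) T = e S₁ T * e S₂ T)
  (hadd₂ : ∀ S T₁ T₂, e S (T₁ + T₂) = e S T₁ * e S T₂)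
  (hgal : ∀ (σ : absoluteGaloisGroup ℚ) (S T : geomTorsion W ((p ^ s * p ^ k : ℕ) : ℤ)), σ • e S T = e (σ • S) (σ • T))
  (inv : LocalInvariants ℚ (p ^ s * p ^ k))
  [Finite (geomTorsion W ((p ^ s * p ^ k : ℕ) : ℤ))] [Finite (geomTorsion W ((p ^ k : ℕ) : ℤ))]

include hμ hadd₁ hadd₂ hgal in
/-- **THE POITOU–TATE COKERNEL BOUND (ii): `#Sel_{p^∞}(E/ℚ) · ∏_{ℓ ∈ T∖{p}} #H¹_ur(ℚ_ℓ, E[p^∞]) ≤ #S · #G₀`**, `G₀ = Sel^{(p^K)}(E/ℚ) ⊓ ker (E[p^K] ↪ E)_*`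
the Kummer image of `E(ℚ)/p^K E(ℚ)` (of order `[E(ℚ) : p^K E(ℚ)]`, part 41 — see the `_index` form below), for Kato's
`S = H¹_{𝓤∞} ⊓ selmerLocalKerPrimary W ℚ_p p` (`p` odd; `T ∋ v_p` containing the bad places; `p^K` killing every `H¹_ur(ℚ_ℓ, E[p^∞])`, `ℓ ∈ T∖p`;
`p^s` killing the `p^s p^K`-torsion of `Ш` (`hs`); a perfect family `inv` of local invariants at level `p^s p^K` with Poitou–Tate's `SelmerComplement`;
a relaxed structure `𝓖′` at level `p^s p^K` as in (★)).  With `#H¹_ur(ℚ_ℓ, E[p^∞]) = p^{v_p(c_ℓ)}` (g18) and, in rank `0`,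
`[E(ℚ) : p^K E(ℚ)] = #E(ℚ)[p^∞]` (`K ≫ 0`), this is `#Ш[p^∞] · ∏_ℓ c_ℓ^{(p)} ≤ #S · #E(ℚ)[p^∞]` — the converse of part 38, the direction crux M consumes.
Count: `∏ #H¹_ur = #Θ(G) ≤ #Θ(ker ev) · [G : ker ev] ≤ #im Λ · #Hom(G₀, ℤ/p^s p^K) = #im Λ · #G₀` ((★), §0) and `#S = #ker Λ · #im Λ`,
`#Sel_{p^∞} ≤ #ker Λ` (part 43). [cite: Kato2004Asterisque, §14.8 (p. 238) and proof of Prop. 14.16 (pp. 244–245)]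
[cite: MilneADT2006, Ch. I, Thm. 4.10 (b) and Lemma 3.3] [cite: GreenbergLNM1716, §5 proof of Prop. 5.8] -/
theorem natCard_selmerGroupPInfty_mul_prod_unramified_le
    (hodd : p ≠ 2) (hk1 : 1 ≤ k)
    (halt : ∀ P, e P P = 1) (hnondeg : ∀ P, (∀ Q, e Q P = 1) → P = 0) (hperf : inv.IsPerfect)
    (hcompl : inv.SelmerComplement)
    (hpT : primePlace p ∈ T) (hT : ∀ v : HeightOneSpectrum (𝓞 ℚ), v ∉ T → W.HasGoodReductionAt v)
    [Finite (W.selmerGroupPInfty p)]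
    (𝓤inf : SelmerStructure (primaryGaloisModule W p))
    (hUp : 𝓤inf (Sum.inr (primePlace p)) = ⊤)
    (hUur : ∀ v : HeightOneSpectrum (𝓞 ℚ), v ≠ primePlace p →
      𝓤inf (Sum.inr v) = unramifiedSubgroup (GaloisRep.toLocal v (primaryGaloisModule W p)) 1)
    (hUinl : ∀ w : InfinitePlace ℚ, 𝓤inf (Sum.inl w) = ⊤)
    (𝓖' : SelmerStructure (W.torsionGaloisModule ((p ^ s * p ^ k : ℕ) : ℤ)))
    (hle : W.kummerSelmerStructure ((p ^ s * p ^ k : ℕ) : ℤ) ≤ 𝓖')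
    (h𝓖good : ∀ v : HeightOneSpectrum (𝓞 ℚ), v ∉ T →
      𝓖' (Sum.inr v) = unramifiedSubgroup (GaloisRep.toLocal v (W.torsionGaloisModule ((p ^ s * p ^ k : ℕ) : ℤ))) 1)
    (h𝓖T : ∀ v ∈ T, v ≠ primePlace p →
      𝓖' (Sum.inr v) = (unramifiedSubgroup (GaloisRep.toLocal v (primaryGaloisModule W p)) 1).comap
        (galoisCohomology.map (((primaryInclusion W p (s + k)).comp
          (W.torsionInclusion (natCast_pow_mul_pow_dvd_natCast_pow_add p s k))).restrictField (v.adicCompletion ℚ)) 1))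
    (h𝓖p : 𝓖' (Sum.inr (primePlace p)) = W.kummerSelmerStructure ((p ^ s * p ^ k : ℕ) : ℤ) (Sum.inr (primePlace p)))
    (hs : ∀ a ∈ W.sha, ((p ^ s * p ^ k : ℕ) : ℤ) • a = 0 → p ^ s • a = 0)
    (hK : ∀ v ∈ T \ {primePlace p},
      ∀ u ∈ unramifiedSubgroup (GaloisRep.toLocal v (primaryGaloisModule W p)) 1, p ^ k • u = 0) :
    Nat.card (W.selmerGroupPInfty p) *
        ∏ v ∈ T \ {primePlace p}, Nat.card (unramifiedSubgroup (GaloisRep.toLocal v (primaryGaloisModule W p)) 1) ≤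
      Nat.card ↥(𝓤inf.selmerGroup ⊓ selmerLocalKerPrimary W ((primePlace p).adicCompletion ℚ) p) *
        Nat.card ↥(selmerGroup W ((p ^ k : ℕ) : ℤ) ⊓ (torsionH1ToH1 W ((p ^ k : ℕ) : ℤ)).ker) := by
  classical
  haveI := neZero_pow p s; haveI := neZero_pow p k
  have hp : p.Prime := Fact.out
  haveI : NeZero (p ^ s * p ^ k) := ⟨mul_ne_zero (pow_ne_zero _ hp.ne_zero) (pow_ne_zero _ hp.ne_zero)⟩
  have hι : ∀ ℓ : ↥(T \ {primePlace p}), ℓ.1 ∈ T ∧ ℓ.1 ≠ primePlace p := fun ℓ => by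
    have h := Finset.mem_sdiff.1 ℓ.2
    exact ⟨h.1, fun h' => h.2 (Finset.mem_singleton.2 h')⟩
  have hpℓ : ∀ ℓ : ↥(T \ {primePlace p}), ((p : ℕ) : 𝓞 ℚ) ∉ ℓ.1.asIdeal := fun ℓ =>
    natCast_not_mem_of_ne_primePlace p (hι ℓ).2
  -- Kato's `S` and its finiteness
  set S := 𝓤inf.selmerGroup ⊓ selmerLocalKerPrimary W ((primePlace p).adicCompletion ℚ) p with hSdef
  haveI : Finite S := finite_kato_rat W p hodd T hpT hT 𝓤inf hUur
  -- the local groups are finite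
  haveI hfinU : ∀ ℓ : ↥(T \ {primePlace p}),
      Finite (galoisCohomology (GaloisRep.toLocal ℓ.1 (primaryGaloisModule W p)) 1) := fun ℓ => by
    haveI : CharZero (ℓ.1.adicCompletion ℚ) := charZero_adicCompletion _
    exact finite_galoisCohomology_one_primary_toLocal W p ℓ.1 (localEulerPoincareCharacteristic_holds _) (hpℓ ℓ)
  haveI hfinUr : ∀ ℓ : ↥(T \ {primePlace p}),
      Finite ↥(unramifiedSubgroup (GaloisRep.toLocal ℓ.1 (primaryGaloisModule W p)) 1) := fun ℓ => inferInstance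
  haveI hfind : ∀ ℓ : ↥(T \ {primePlace p}),
      Finite (galoisCohomology ((W.torsionGaloisModule ((p ^ k : ℕ) : ℤ)).toLocal (Sum.inr ℓ.1)) 1) := fun ℓ =>
    finite_galoisCohomology_one_toLocal _ _
  -- `G = ∏ ι_K⁻¹ H¹_ur ≤ ∏ H¹(ℚ_ℓ, E[p^K])`
  let C := fun ℓ : ↥(T \ {primePlace p}) =>
    (unramifiedSubgroup (GaloisRep.toLocal ℓ.1 (primaryGaloisModule W p)) 1).comap
      (galoisCohomology.map ((primaryInclusion W p k).restrictField (ℓ.1.adicCompletion ℚ)) 1)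
  haveI hfinC : ∀ ℓ, Finite (C ℓ) := fun ℓ =>
    Finite.of_injective (fun z : C ℓ =>
      @id (galoisCohomology ((W.torsionGaloisModule ((p ^ k : ℕ) : ℤ)).toLocal (Sum.inr ℓ.1)) 1) z.1)
      (fun a b h => Subtype.ext h)
  -- `G₀ = Sel^{(p^K)} ⊓ ker (E[p^K] ↪ E)_*`, finite, killed by `p^s p^K`, of order `[E(ℚ) : p^K E(ℚ)]`
  have hn0 : ((p ^ k : ℕ) : ℤ) ≠ 0 := Int.natCast_ne_zero.mpr (pow_ne_zero _ hp.ne_zero)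
  haveI : Finite (selmerGroup W ((p ^ k : ℕ) : ℤ)) := W.finite_selmerGroup_holds hn0
  haveI hfinG₀ : Finite ↥(selmerGroup W ((p ^ k : ℕ) : ℤ) ⊓ (torsionH1ToH1 W ((p ^ k : ℕ) : ℤ)).ker) :=
    Finite.of_injective (AddSubgroup.inclusion inf_le_left) (AddSubgroup.inclusion_injective _)
  have hMd : ∀ m : geomTorsion W ((p ^ k : ℕ) : ℤ), (p ^ s * p ^ k) • m = 0 := fun m => by
    rw [mul_smul, pow_nsmul_geomTorsion_eq_zero, smul_zero]
  have hG₀' : ∀ c : galoisCohomology (W.torsionGaloisModule ((p ^ k : ℕ) : ℤ)) 1, (p ^ s * p ^ k) • c = 0 :=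
    galoisCohomology.nsmul_eq_zero_of_forall _ hMd
  have hG₀ : ∀ x : ↥(selmerGroup W ((p ^ k : ℕ) : ℤ) ⊓ (torsionH1ToH1 W ((p ^ k : ℕ) : ℤ)).ker),
      (p ^ s * p ^ k) • x = 0 := fun x => Subtype.ext (hG₀' x.1)
  -- `Θ : G → ∏ H¹_ur`, surjective (part 43, `p^K` kills `H¹_ur`)
  let θ : ∀ ℓ : ↥(T \ {primePlace p}),
      (∀ ℓ, C ℓ) →+ ↥(unramifiedSubgroup (GaloisRep.toLocal ℓ.1 (primaryGaloisModule W p)) 1) := fun ℓ =>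
    { toFun := fun g =>
        ⟨galoisCohomology.map ((primaryInclusion W p k).restrictField (ℓ.1.adicCompletion ℚ)) 1 (g ℓ).1, (g ℓ).2⟩
      map_zero' := Subtype.ext (map_zero _)
      map_add' := fun a b => Subtype.ext (map_add _ _ _) }
  let Θ := AddMonoidHom.pi θ
  have hΘ : Function.Surjective Θ := fun u => by
    have hex : ∀ ℓ : ↥(T \ {primePlace p}), ∃ z ∈ C ℓ,
        galoisCohomology.map ((primaryInclusion W p k).restrictField (ℓ.1.adicCompletion ℚ)) 1 z = (u ℓ).1 := fun ℓ =>
      exists_mem_comap_map_primaryInclusion_eq W p k ℓ.1 (u ℓ).2 (hK ℓ.1 ℓ.2 _ (u ℓ).2)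
    choose z hz hzu using hex
    exact ⟨fun ℓ => ⟨z ℓ, hz ℓ⟩, funext fun ℓ => Subtype.ext (hzu ℓ)⟩
  -- `Λ : S → ∏ H¹_ur` (localisation), `Sel_{p^∞} ≤ ker Λ` (part 43)
  have hmemU : ∀ (c : S) (ℓ : ↥(T \ {primePlace p})),
      galoisCohomology.localization (primaryGaloisModule W p) (Sum.inr ℓ.1) 1
          (c : galoisCohomology (primaryGaloisModule W p) 1) ∈
        unramifiedSubgroup (GaloisRep.toLocal ℓ.1 (primaryGaloisModule W p)) 1 := fun c ℓ => by
    have h := (SelmerStructure.mem_selmerGroup_iff _ _).1 c.2.1 (Sum.inr ℓ.1)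
    rw [hUur ℓ.1 (hι ℓ).2] at h
    exact h
  let lam : ∀ ℓ : ↥(T \ {primePlace p}), S →+ ↥(unramifiedSubgroup (GaloisRep.toLocal ℓ.1 (primaryGaloisModule W p)) 1) :=
    fun ℓ =>
    { toFun := fun c => ⟨galoisCohomology.localization (primaryGaloisModule W p) (Sum.inr ℓ.1) 1
          (c : galoisCohomology (primaryGaloisModule W p) 1), hmemU c ℓ⟩
      map_zero' := Subtype.ext (map_zero _)
      map_add' := fun a b => Subtype.ext (map_add _ _ _) }
  let Λ := AddMonoidHom.pi lam
  have hSel : Nat.card (W.selmerGroupPInfty p) ≤ Nat.card Λ.ker := by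
    refine Nat.card_le_card_of_injective
      (fun c => (⟨⟨@id (galoisCohomology (primaryGaloisModule W p) 1) c.1,
          selmerGroupPInfty_le_kato W p 𝓤inf hUp hUur hUinl c.2⟩,
        (AddMonoidHom.mem_ker).2 (funext fun ℓ => Subtype.ext
          (localization_eq_zero_of_mem_selmerGroupPInfty W p (hι ℓ).2 c.2))⟩ : Λ.ker)) ?_
    intro a b h
    have h' := congrArg (fun x : Λ.ker => @id (galoisCohomology (primaryGaloisModule W p) 1) x.1.1) h
    exact Subtype.ext h'
  -- the functionals `ev : G → Hom(G₀, ℤ/p^s p^K)`, `ev g x = Σ_ℓ ⟨g_ℓ, (desc^♭)_* loc_ℓ x⟩_ℓ`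
  let δ : ∀ ℓ : ↥(T \ {primePlace p}),
      ↥(selmerGroup W ((p ^ k : ℕ) : ℤ) ⊓ (torsionH1ToH1 W ((p ^ k : ℕ) : ℤ)).ker) →+ _ := fun ℓ =>
    ((galoisCohomology.map ((DiscreteGaloisModule.pairingDualIntertwining
        (ρ₁ := W.torsionGaloisModule ((p ^ k : ℕ) : ℤ)) (ρ₂ := W.torsionGaloisModule ((p ^ k : ℕ) : ℤ))
        (B := descendHom W (p ^ s) (p ^ k) e hμ hadd₁ hadd₂)
        (descendHom_smul W (p ^ s) (p ^ k) e hμ hadd₁ hadd₂ hgal)).restrictField (ℓ.1.adicCompletion ℚ)) 1).comp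
      (galoisCohomology.localization (W.torsionGaloisModule ((p ^ k : ℕ) : ℤ)) (Sum.inr ℓ.1) 1)).comp
      (selmerGroup W ((p ^ k : ℕ) : ℤ) ⊓ (torsionH1ToH1 W ((p ^ k : ℕ) : ℤ)).ker).subtype
  let π : ∀ ℓ : ↥(T \ {primePlace p}), (∀ ℓ, C ℓ) →+ _ := fun ℓ =>
    (C ℓ).subtype.comp (Pi.evalAddMonoidHom (fun ℓ => ↥(C ℓ)) ℓ)
  set ev : (∀ ℓ, C ℓ) →+ (↥(selmerGroup W ((p ^ k : ℕ) : ℤ) ⊓ (torsionH1ToH1 W ((p ^ k : ℕ) : ℤ)).ker) →+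
      ZMod (p ^ s * p ^ k)) :=
    ∑ ℓ : ↥(T \ {primePlace p}),
      ((localTatePairingZMod (W.torsionGaloisModule ((p ^ k : ℕ) : ℤ)) (p ^ s * p ^ k) (Sum.inr ℓ.1)
        (inv (Sum.inr ℓ.1))).compl₂ (δ ℓ)).comp (π ℓ) with hev_def
  have hev : ∀ g x, ev g x = ∑ ℓ : ↥(T \ {primePlace p}),
        localTatePairingZMod (W.torsionGaloisModule ((p ^ k : ℕ) : ℤ)) (p ^ s * p ^ k) (Sum.inr ℓ.1) (inv (Sum.inr ℓ.1))
          (g ℓ).1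
          (galoisCohomology.map ((DiscreteGaloisModule.pairingDualIntertwining
              (ρ₁ := W.torsionGaloisModule ((p ^ k : ℕ) : ℤ)) (ρ₂ := W.torsionGaloisModule ((p ^ k : ℕ) : ℤ))
              (B := descendHom W (p ^ s) (p ^ k) e hμ hadd₁ hadd₂)
              (descendHom_smul W (p ^ s) (p ^ k) e hμ hadd₁ hadd₂ hgal)).restrictField (ℓ.1.adicCompletion ℚ)) 1
            (galoisCohomology.localization (W.torsionGaloisModule ((p ^ k : ℕ) : ℤ)) (Sum.inr ℓ.1) 1 x.1)) := fun g x => by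
    rw [hev_def, AddMonoidHom.finsetSum_apply, AddMonoidHom.finsetSum_apply]
    rfl
  -- (★): `Θ(ker ev) ≤ im Λ`
  have hker : ev.ker.map Θ ≤ Λ.range := by
    rintro _ ⟨g, hg, rfl⟩
    have hg' : ∀ x ∈ selmerGroup W ((p ^ k : ℕ) : ℤ) ⊓ (torsionH1ToH1 W ((p ^ k : ℕ) : ℤ)).ker,
        ∑ ℓ : ↥(T \ {primePlace p}),
          localTatePairingZMod (W.torsionGaloisModule ((p ^ k : ℕ) : ℤ)) (p ^ s * p ^ k) (Sum.inr ℓ.1) (inv (Sum.inr ℓ.1))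
            (g ℓ).1
            (galoisCohomology.map ((DiscreteGaloisModule.pairingDualIntertwining
                (ρ₁ := W.torsionGaloisModule ((p ^ k : ℕ) : ℤ)) (ρ₂ := W.torsionGaloisModule ((p ^ k : ℕ) : ℤ))
                (B := descendHom W (p ^ s) (p ^ k) e hμ hadd₁ hadd₂)
                (descendHom_smul W (p ^ s) (p ^ k) e hμ hadd₁ hadd₂ hgal)).restrictField (ℓ.1.adicCompletion ℚ)) 1
              (galoisCohomology.localization (W.torsionGaloisModule ((p ^ k : ℕ) : ℤ)) (Sum.inr ℓ.1) 1 x)) = 0 :=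
      fun x hx => by
        rw [← hev g ⟨x, hx⟩, (AddMonoidHom.mem_ker).1 hg, AddMonoidHom.zero_apply]
    obtain ⟨c, hcS, hcloc⟩ := exists_mem_kato_of_sum_eq_zero W p s k T e hμ hadd₁ hadd₂ hgal inv hodd hk1 halt hnondeg
      hperf hcompl hpT hT 𝓤inf hUp hUur hUinl 𝓖' hle h𝓖good h𝓖T h𝓖p hs g hg'
    exact AddMonoidHom.mem_range.2 ⟨⟨c, hcS⟩, funext fun ℓ => Subtype.ext (hcloc ℓ)⟩
  -- the count
  have h1 : Nat.card (∀ ℓ : ↥(T \ {primePlace p}), ↥(unramifiedSubgroup (GaloisRep.toLocal ℓ.1 (primaryGaloisModule W p)) 1)) ≤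
      Nat.card (ev.ker.map Θ) * ev.ker.index := natCard_le_natCard_map_mul_index Θ hΘ ev.ker
  have h2 : Nat.card (ev.ker.map Θ) ≤ Nat.card Λ.range := AddSubgroup.card_le_of_le hker
  have h3 : ev.ker.index ≤ Nat.card ↥(selmerGroup W ((p ^ k : ℕ) : ℤ) ⊓ (torsionH1ToH1 W ((p ^ k : ℕ) : ℤ)).ker) :=
    index_ker_le_natCard hG₀ ev
  have h5 : Nat.card S = Nat.card Λ.ker * Nat.card Λ.range := by
    rw [AddSubgroup.card_eq_card_quotient_mul_card_addSubgroup Λ.ker, mul_comm,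
      Nat.card_congr (QuotientAddGroup.quotientKerEquivRange Λ).toEquiv]
  calc Nat.card (W.selmerGroupPInfty p) *
        ∏ v ∈ T \ {primePlace p}, Nat.card (unramifiedSubgroup (GaloisRep.toLocal v (primaryGaloisModule W p)) 1)
      = Nat.card (W.selmerGroupPInfty p) *
          Nat.card (∀ ℓ : ↥(T \ {primePlace p}), ↥(unramifiedSubgroup (GaloisRep.toLocal ℓ.1 (primaryGaloisModule W p)) 1)) := by
        rw [← Finset.prod_coe_sort, ← Nat.card_pi]
    _ ≤ Nat.card Λ.ker * (Nat.card Λ.range *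
          Nat.card ↥(selmerGroup W ((p ^ k : ℕ) : ℤ) ⊓ (torsionH1ToH1 W ((p ^ k : ℕ) : ℤ)).ker)) :=
        Nat.mul_le_mul hSel (h1.trans (Nat.mul_le_mul h2 h3))
    _ = Nat.card S * Nat.card ↥(selmerGroup W ((p ^ k : ℕ) : ℤ) ⊓ (torsionH1ToH1 W ((p ^ k : ℕ) : ℤ)).ker) := by
        rw [← mul_assoc, ← h5]

include hμ hadd₁ hadd₂ hgal in
/-- **(ii) with the Mordell–Weil index: `#Sel_{p^∞}(E/ℚ) · ∏_{ℓ ∈ T∖{p}} #H¹_ur(ℚ_ℓ, E[p^∞]) ≤ #S · [E(ℚ) : p^K E(ℚ)]`** — the last factor of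
`natCard_selmerGroupPInfty_mul_prod_unramified_le` is the order of the Kummer image `E(ℚ)/p^K E(ℚ) ↪ H¹(ℚ, E[p^K])` (part 41,
`natCard_selmerGroup_inf_ker_torsionH1ToH1`; `= #E(ℚ)[p^∞]` in rank `0` for `K ≫ 0`). [cite: SilvermanAEC2009, VIII §2 and Thm. X.4.2 (a)]
[cite: Kato2004Asterisque, §14.8 (p. 238)] -/
theorem natCard_selmerGroupPInfty_mul_prod_unramified_le_index
    (hodd : p ≠ 2) (hk1 : 1 ≤ k)
    (halt : ∀ P, e P P = 1) (hnondeg : ∀ P, (∀ Q, e Q P = 1) → P = 0) (hperf : inv.IsPerfect)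
    (hcompl : inv.SelmerComplement)
    (hpT : primePlace p ∈ T) (hT : ∀ v : HeightOneSpectrum (𝓞 ℚ), v ∉ T → W.HasGoodReductionAt v)
    [Finite (W.selmerGroupPInfty p)]
    (𝓤inf : SelmerStructure (primaryGaloisModule W p))
    (hUp : 𝓤inf (Sum.inr (primePlace p)) = ⊤)
    (hUur : ∀ v : HeightOneSpectrum (𝓞 ℚ), v ≠ primePlace p →
      𝓤inf (Sum.inr v) = unramifiedSubgroup (GaloisRep.toLocal v (primaryGaloisModule W p)) 1)
    (hUinl : ∀ w : InfinitePlace ℚ, 𝓤inf (Sum.inl w) = ⊤)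
    (𝓖' : SelmerStructure (W.torsionGaloisModule ((p ^ s * p ^ k : ℕ) : ℤ)))
    (hle : W.kummerSelmerStructure ((p ^ s * p ^ k : ℕ) : ℤ) ≤ 𝓖')
    (h𝓖good : ∀ v : HeightOneSpectrum (𝓞 ℚ), v ∉ T →
      𝓖' (Sum.inr v) = unramifiedSubgroup (GaloisRep.toLocal v (W.torsionGaloisModule ((p ^ s * p ^ k : ℕ) : ℤ))) 1)
    (h𝓖T : ∀ v ∈ T, v ≠ primePlace p →
      𝓖' (Sum.inr v) = (unramifiedSubgroup (GaloisRep.toLocal v (primaryGaloisModule W p)) 1).comap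
        (galoisCohomology.map (((primaryInclusion W p (s + k)).comp
          (W.torsionInclusion (natCast_pow_mul_pow_dvd_natCast_pow_add p s k))).restrictField (v.adicCompletion ℚ)) 1))
    (h𝓖p : 𝓖' (Sum.inr (primePlace p)) = W.kummerSelmerStructure ((p ^ s * p ^ k : ℕ) : ℤ) (Sum.inr (primePlace p)))
    (hs : ∀ a ∈ W.sha, ((p ^ s * p ^ k : ℕ) : ℤ) • a = 0 → p ^ s • a = 0)
    (hK : ∀ v ∈ T \ {primePlace p},
      ∀ u ∈ unramifiedSubgroup (GaloisRep.toLocal v (primaryGaloisModule W p)) 1, p ^ k • u = 0) :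
    Nat.card (W.selmerGroupPInfty p) *
        ∏ v ∈ T \ {primePlace p}, Nat.card (unramifiedSubgroup (GaloisRep.toLocal v (primaryGaloisModule W p)) 1) ≤
      Nat.card ↥(𝓤inf.selmerGroup ⊓ selmerLocalKerPrimary W ((primePlace p).adicCompletion ℚ) p) *
        (zsmulAddGroupHom ((p ^ k : ℕ) : ℤ) : W.toAffine.Point →+ W.toAffine.Point).range.index := by
  have hn0 : ((p ^ k : ℕ) : ℤ) ≠ 0 := Int.natCast_ne_zero.mpr (pow_ne_zero _ (Fact.out : p.Prime).ne_zero)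
  have h := natCard_selmerGroupPInfty_mul_prod_unramified_le W p s k T e hμ hadd₁ hadd₂ hgal inv hodd hk1 halt hnondeg
    hperf hcompl hpT hT 𝓤inf hUp hUur hUinl 𝓖' hle h𝓖good h𝓖T h𝓖p hs hK
  rw [natCard_selmerGroup_inf_ker_torsionH1ToH1 W hn0] at h
  convert h

end PT

end Summit.BirchSwinnertonDyer.BirchSwinnertonDyer.Theorems.KatoFiniteLevelCount

end
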